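import Summits.HubbardSuperconductivity.HubbardSuperconductivity.Theorems.AnisotropyChordTransferFibre3Level2RowA
import Summits.HubbardSuperconductivity.HubbardSuperconductivity.Theorems.AnisotropyChordTransferFibre3ManifoldBand

/-!
# Route `AnisotropyChord` / H0 rotor rung: PartN41-A (family A for Level 2) — every target PROVED

The seven `def … : Prop` targets of the ported statement file `…Fibre3Level2RowA` (theory-1 g22 PartN41A, «FINAL» c1c48673ef9ec346)
follow from the content theorems of `…Fibre3ManifoldA` / `…Fibre3ManifoldBand` (p1 g26):
`manifoldDictionary_holds`, `deltaFromCell_holds`, `axisWindowClosed_holds`, `secondShellWindow_holds`, `nuCeiling_holds`,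
`manifoldBand_holds` (amended form), `manifoldEquation_holds`.
Prover seat `hubbard-h0-rotor-p1` g26 (route lead); helper for stmt-HubbardSuperconductivity-23918 (`--supports`, helper class).
WHAT THIS IS NOT: nothing here proves superconductivity in the Hubbard model; family-A row of the Level-2 certificate of ONE conditional reduction.
Tree imports only; no new definitions; no sorry, no axioms.
-/

set_option linter.dupNamespace false
set_option autoImplicit false

noncomputable section

namespace Summit.HubbardSuperconductivity.HubbardSuperconductivity.Theorems.AnisotropyChord.Transfer.Fibre3

variable (L : ℕ) [NeZero L]

/-- ★ `ManifoldDictionary L Δ` holds (every `Δ`; the hypotheses `5 ≤ L`, `0 ≤ Δ < 1` are inside). [folklore] -/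
theorem manifoldDictionary_holds (Δ : ℝ) : ManifoldDictionary L Δ := by
  intro lam2 f hL hΔ0 hΔ1 hf
  exact ManifoldA.manifold_dictionary L hL hΔ0 hΔ1 hf

/-- ★ `DeltaFromCell L Δ` holds. [folklore] -/
theorem deltaFromCell_holds (Δ : ℝ) : DeltaFromCell L Δ := by
  intro lam2 f hL hΔ0 hΔ1 hf
  exact ManifoldA.delta_from_cell L hL hΔ0 hΔ1 hf

/-- ★ `AxisWindowClosed L Δ` holds. [folklore] -/
theorem axisWindowClosed_holds (Δ : ℝ) : AxisWindowClosed L Δ := by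
  intro lam2 f hL hΔ0 hΔ1 hf
  exact ManifoldA.axis_window_closed L hL hΔ0 hΔ1 hf

/-- ★ `ManifoldEquation L Δ` holds. [folklore] -/
theorem manifoldEquation_holds (Δ : ℝ) : ManifoldEquation L Δ := by
  intro lam2 f hL hΔ0 hΔ1 hf
  exact ManifoldA.manifold_equation L hL hΔ0 hΔ1 hf

omit [NeZero L] in
/-- ★ `SecondShellWindow` holds. [folklore] -/
theorem secondShellWindow_holds : SecondShellWindow := by
  intro L _ hL ν hν0 hν
  exact ManifoldA.second_shell_window L hL ν hν0 hν

omit [NeZero L] in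
/-- ★ `NuCeiling` holds. [folklore] -/
theorem nuCeiling_holds : NuCeiling := by
  intro L _ hL Δ lam2 f hΔ0 hΔ1 hf
  exact ManifoldA.nu_ceiling L hL hΔ0.le hf

omit [NeZero L] in
/-- ★ `ManifoldBand` holds (amended form). [folklore] -/
theorem manifoldBand_holds : ManifoldBand := by
  intro L _ hL Δ lam2 f hΔ0 hΔ1 hf
  exact ManifoldA.manifold_band L hL hΔ0 hΔ1 hf

end Summit.HubbardSuperconductivity.HubbardSuperconductivity.Theorems.AnisotropyChord.Transfer.Fibre3

end
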